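import Literature.NumberTheory.EllipticCurves.KuriharaSumFunctionalEquation
import Literature.NumberTheory.EllipticCurves.KuriharaNumberParity
import Literature.NumberTheory.EllipticCurves.Kim2025.CorankStructureOPEN
import Literature.NumberTheory.EllipticCurves.PAdicLFunctionFrickeSymmetryProofs
import Literature.NumberTheory.EllipticCurves.PAdicLFunctionDistributionProofs
import Literature.NumberTheory.EllipticCurves.PAdicLFunctionDistributionHoldsProofs
import Literature.NumberTheory.EllipticCurves.PAdicLFunctionProofs
import Literature.NumberTheory.EllipticCurves.PAdicLFunctionNeZeroProofs
import Literature.NumberTheory.EllipticCurves.ModularityVersionApProofs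
import Literature.NumberTheory.EllipticCurves.NonEisensteinPrimeOfSurjective
import Literature.NumberTheory.EllipticCurves.HeegnerPointReflectionProofs
import Literature.NumberTheory.EllipticCurves.CuspFormLFunctionNewformFrickeProofs
import Literature.NumberTheory.EllipticCurves.PAdicLFunctionNonvanishingProofs
import Literature.NumberTheory.EllipticCurves.CuspFormLFunctionLevelConductorProofs
import Literature.Barriers.BirchSwinnertonDyer.PAdicFunctionalEquationParityProofs
import HarnessLib

/-!
# Parity vanishing of Kurihara numbers: proofs (Kim 2026, Prop. 3.14; Kurihara 2014, Lemma 5.2.1)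

Topic `NumberTheory/EllipticCurves`; namespace `Literature.NumberTheory.EllipticCurves`. PROVED
theorems only (no definitions, no named facts). Companion of `KuriharaNumberParity` (the named fact
`Kim2022_kuriharaNumber_eq_zero_of_neg_one_pow_ne_rootNumber`) and of
`Kim2025/CorankStructureOPEN` (its `p ≥ 3` twin `Kim2025.prop25_…_OPEN`), written by the
cross-ladder literature-typing layer (cell `bsd-littype`, seat 09).

## What is proved

For the newform `f ∈ S₂(Γ₀(N))` of an elliptic curve `W/ℚ` (`IsNewformOf W f`), an odd prime `p` with
`E[p]` irreducible, `k ≥ 0`, a level `n ∈ 𝒩_k` (`Kato.IsKolyvaginProduct W p k n`: square-free, every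
`ℓ ∣ n` a prime with `ℓ ∤ N_W p`, `ℓ ≡ 1`, `a_ℓ ≡ ℓ + 1 (mod p^k)`) and ANY family of discrete
logarithms `ψ_ℓ : (ℤ/ℓ)ˣ → ℤ/p^k`:

* `kuriharaNumber_eq_frickeSign_mul` — **the functional equation** (Kim, Amer. J. Math. 148 (2026),
  §3.5 eq. (3.3); Kim 2025, eq. (2.1); Mazur–Tate 1987, (1.6.2)) in the Fricke-sign currency: if
  `w_N f = -σ f` (`σ = ±1`; `σ = -ε(f)`), then `δ_n = σ·(−1)^{ν(n)}·δ_n` in `ℤ/p^k` for the tree's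
  `δ_n = kuriharaNumber f (p^k) n ψ`; `kuriharaNumber_eq_zero_of_neg_one_pow_ne_frickeSign` — hence
  `δ_n = 0` if `(−1)^{ν(n)} ≠ σ`. UNCONDITIONAL.
* `kuriharaNumber_eq_rootNumber_mul_conductorLevel`,
  `kuriharaNumber_eq_zero_of_neg_one_pow_ne_rootNumber_conductorLevel` — the same with `σ = w(E)`
  the global root number, for `f` at the conductor level `N = N_W` (`w(E) = −ε(f)`,
  `rootNumber_eq_neg_frickeEigenvalue`). UNCONDITIONAL.
* `even_card_primeFactors_iff_even_analyticRank_of_kuriharaNumber_ne_zero` — Kurihara 2014,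
  Lemma 5.2.1 as printed ("`ε = (−1)^{ε(m)}`" at a level `m` with `δ̃_m ≠ 0`) combined with the
  parity of the analytic rank (`Even r_an ↔ w(E) = 1`, Silverman AEC C.16; tree
  `even_analyticRank_iff_of_isNewformOf_conductorLevel`): a level `n` carrying a non-zero mod-`p^k`
  Kurihara number has `ν(n) ≡ ord_{s=1} L(E,s) (mod 2)`. UNCONDITIONAL (at `N = N_W`); hence
  `kuriharaNumber_mul_eq_zero_of_kuriharaNumber_ne_zero_conductorLevel` — Prop. 3.14's second clause
  "if `δ̃_n ≠ 0` then `δ̃_{nℓ} = 0`".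
* `Kim2022_kuriharaNumber_eq_zero_of_neg_one_pow_ne_rootNumber_of_exists_isNewformOf` and
  `Kim2025.prop25_kuriharaNumber_eq_zero_of_neg_one_pow_ne_rootNumber_OPEN_of_exists_isNewformOf` —
  the named fact of `KuriharaNumberParity` (REFEREED, `p ≥ 5`, `ρ̄` onto) and its OPEN `p ≥ 3` twin
  both FOLLOW from modularity in the tree's form `exists_isNewformOf` (a newform of `W` at level `N_W`
  exists): the facts quantify over newforms of `W` at EVERY level `N`, and the link `w(E) = −ε(f)` is
  available at `N = N_W` only (`IsNewformOf.level_eq_level` + `exists_isNewformOf` pin `N = N_W`;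
  equivalently Carayol's `IsNewformOf.level_eq_conductorNorm`). No other input: the trust base of the
  two facts is reduced to that of `exists_isNewformOf`.

## Proof

The algebra is `KuriharaSumFunctionalEquation` (abstract symbol `Λ : ℚ → R`). Here `R = ℤ/p^k`,
`Λ(r) = \overline{[r]⁺_f} = ratModP (p^k) (ratPlusSymbol f r)` and `χ_{d,ℓ} = ψ_ℓ ∘ (a ↦ a mod ℓ)`; the
three hypotheses are supplied by the tree: (P) `[r + 1]⁺ = [r]⁺` (`ratPlusSymbol_add_intCast_eq`);
(H) the Hecke relation `a_ℓ [r]⁺ = Σ_j [(r + j)/ℓ]⁺ + [ℓ r]⁺` (`intCast_mul_ratPlusSymbol`, MTT (4.2))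
with `a_ℓ(f) = a_ℓ(W) ≡ 2` (`cuspCoeff_eq_frobeniusTrace_of_isNewformOf_holds`,
`Kato.isKolyvaginPrime_iff_zmod`), reduced mod `p^k` through `ℤ_p` using the `p`-integrality of the
symbols at levels prime to `N` (`IsNewformOf.norm_ratPlusSymbol_div_le_one`, `E[p]` irreducible);
(F) the Fricke symmetry `[u/n]⁺ = σ [v/n]⁺` for `a n − u N v = 1`
(`IsFrickeEigen.normalizedPlusSymbol_div_eq_mul`, `ratPlusSymbol_eq_mul_of_normalizedPlusSymbol_eq`).
The Kurihara number is the top sum `D_n(primes n)` by definition (`kuriharaNumber_def`).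

## References
* [Kim2022StructureSelmer] C.-H. Kim, Amer. J. Math. 148 (2026) = arXiv:2203.12159, §3.5 eq. (3.3),
  Prop. 3.14 (journal) = Prop. 3.16 (arXiv v3, held chunk p0019).
* [Kurihara2014] M. Kurihara, Contrib. Math. Comput. Sci. 7 (2014), Lemma 5.2.1.
* [MazurTate1987] B. Mazur, J. Tate, Duke Math. J. 54 (1987), (1.6.2).
* [Kim2025RefinedTNC] C.-H. Kim, arXiv:2505.09121v1, Prop. 2.5, eq. (2.1).
-/

noncomputable section

open scoped MatrixGroups ModularForm Classical

open CongruenceSubgroup Literature.NumberTheory.EllipticCurves.ModularForms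

open Literature.NumberTheory.DiophantineGeometry.Dioph (ratModP)

namespace Literature.NumberTheory.EllipticCurves

/-! ### Reduction of `p`-integral rationals mod `p^k` is additive (through `ℤ_p`) -/

section Reduction

variable {p : ℕ} [Fact p.Prime] (k : ℕ)

/-- `ratModP (p^k) q = (x mod p^k)` for any `p`-adic integer `x` lifting `q`. [folklore] -/
private theorem ratModP_pow_eq_toZModPow {q : ℚ} {x : ℤ_[p]} (hx : (x : ℚ_[p]) = (q : ℚ_[p])) :
    ratModP (p ^ k) q = PadicInt.toZModPow k x := by
  have hq : ¬ p ∣ q.den :=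
    not_dvd_den_of_norm_ratCast_le_one (by rw [← hx]; exact PadicInt.norm_le_one x)
  rw [ratModP_eq_toZModPow p k hq]
  congr 1
  exact PadicInt.ext hx.symm

/-- `p`-integral rationals are closed under addition (ultrametric inequality). [folklore] -/
private theorem norm_ratCast_add_le_one {q₁ q₂ : ℚ} (h₁ : ‖((q₁ : ℚ) : ℚ_[p])‖ ≤ 1)
    (h₂ : ‖((q₂ : ℚ) : ℚ_[p])‖ ≤ 1) : ‖((q₁ + q₂ : ℚ) : ℚ_[p])‖ ≤ 1 := by
  obtain ⟨x₁, hx₁⟩ : ∃ x : ℤ_[p], (x : ℚ_[p]) = (q₁ : ℚ_[p]) := ⟨⟨_, h₁⟩, rfl⟩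
  obtain ⟨x₂, hx₂⟩ : ∃ x : ℤ_[p], (x : ℚ_[p]) = (q₂ : ℚ_[p]) := ⟨⟨_, h₂⟩, rfl⟩
  have h := PadicInt.norm_le_one (x₁ + x₂)
  rw [PadicInt.norm_def, PadicInt.coe_add, hx₁, hx₂] at h
  rw [Rat.cast_add]
  exact h

/-- Additivity of the reduction mod `p^k` on `p`-integral rationals. [folklore] -/
private theorem ratModP_pow_add {q₁ q₂ : ℚ} (h₁ : ‖((q₁ : ℚ) : ℚ_[p])‖ ≤ 1)
    (h₂ : ‖((q₂ : ℚ) : ℚ_[p])‖ ≤ 1) :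
    ratModP (p ^ k) (q₁ + q₂) = ratModP (p ^ k) q₁ + ratModP (p ^ k) q₂ := by
  obtain ⟨x₁, hx₁⟩ : ∃ x : ℤ_[p], (x : ℚ_[p]) = (q₁ : ℚ_[p]) := ⟨⟨_, h₁⟩, rfl⟩
  obtain ⟨x₂, hx₂⟩ : ∃ x : ℤ_[p], (x : ℚ_[p]) = (q₂ : ℚ_[p]) := ⟨⟨_, h₂⟩, rfl⟩
  rw [ratModP_pow_eq_toZModPow k (x := x₁ + x₂) (by rw [PadicInt.coe_add, Rat.cast_add, hx₁, hx₂]),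
    ratModP_pow_eq_toZModPow k hx₁, ratModP_pow_eq_toZModPow k hx₂, map_add]

/-- Multiplicativity of the reduction mod `p^k` against integers. [folklore] -/
private theorem ratModP_pow_intCast_mul (z : ℤ) {q : ℚ} (h : ‖((q : ℚ) : ℚ_[p])‖ ≤ 1) :
    ratModP (p ^ k) (z * q) = (z : ZMod (p ^ k)) * ratModP (p ^ k) q := by
  obtain ⟨x, hx⟩ : ∃ x : ℤ_[p], (x : ℚ_[p]) = (q : ℚ_[p]) := ⟨⟨_, h⟩, rfl⟩
  rw [ratModP_pow_eq_toZModPow k (x := (z : ℤ_[p]) * x)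
      (by rw [PadicInt.coe_mul, PadicInt.coe_intCast, Rat.cast_mul, Rat.cast_intCast, hx]),
    ratModP_pow_eq_toZModPow k hx, map_mul, map_intCast]

/-- Additivity of the reduction mod `p^k` over finite sums of `p`-integral rationals (and such sums
are `p`-integral). [folklore] -/
private theorem ratModP_pow_sum {ι : Type*} (s : Finset ι) (q : ι → ℚ)
    (hq : ∀ i ∈ s, ‖((q i : ℚ) : ℚ_[p])‖ ≤ 1) :
    ratModP (p ^ k) (∑ i ∈ s, q i) = ∑ i ∈ s, ratModP (p ^ k) (q i) ∧
      ‖((∑ i ∈ s, q i : ℚ) : ℚ_[p])‖ ≤ 1 := by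
  classical
  induction s using Finset.induction_on with
  | empty => simp
  | @insert a s ha ih =>
    have ha1 := hq a (Finset.mem_insert_self a s)
    obtain ⟨ih1, ih2⟩ := ih (fun i hi => hq i (Finset.mem_insert_of_mem hi))
    rw [Finset.sum_insert ha, Finset.sum_insert ha, ratModP_pow_add k ha1 ih2, ih1]
    exact ⟨rfl, norm_ratCast_add_le_one ha1 ih2⟩

end Reduction

/-! ### The functional equation in the Fricke-sign currency (unconditional) -/

section FrickeSign

variable {N : ℕ} [NeZero N] {f : CuspForm (Gamma0 N) 2} {p : ℕ} [Fact p.Prime]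
  {W : WeierstrassCurve ℚ} [W.IsElliptic] [W.IsGloballyMinimal]

/-- **(H) reduced mod `p^k`.** For the newform `f` of `W` (`E[p]` irreducible, `p` odd), a Kolyvagin
prime `ℓ ∈ 𝒫_k` and a level `d ≥ 1` prime to `N`: in `ℤ/p^k`,
`2·\overline{[v/d]⁺} = Σ_{j mod ℓ} \overline{[(v/d + j)/ℓ]⁺} + \overline{[ℓv/d]⁺}` — the Hecke relation
`a_ℓ [r]⁺ = Σ_j [(r+j)/ℓ]⁺ + [ℓ r]⁺` (Mazur–Tate–Teitelbaum 1986, (4.2); `intCast_mul_ratPlusSymbol`)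
with `a_ℓ(f) = a_ℓ(W) ≡ ℓ + 1 ≡ 2 (mod p^k)` (Kim 2022, §1.2.2), all symbols being `p`-integral
(`IsNewformOf.norm_ratPlusSymbol_div_le_one`). [cite: MazurTateTeitelbaum1986Invent, §I.4 (4.2)] -/
theorem two_mul_ratModP_ratPlusSymbol_eq_of_isKolyvaginPrime (hp2 : p ≠ 2)
    (hirr : W.HasIrreducibleModPGaloisRep p) (hf : IsNewformOf W f) {k ℓ : ℕ}
    (hℓK : Kato.IsKolyvaginPrime W p k ℓ) {d : ℕ} (hd0 : d ≠ 0) (hdN : Nat.Coprime d N) (v : ℤ) :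
    (2 : ZMod (p ^ k)) * ratModP (p ^ k) (ratPlusSymbol f ((v : ℚ) / d)) =
      ∑ j : Fin ℓ, ratModP (p ^ k) (ratPlusSymbol f (((v : ℚ) / d + ((j : ℕ) : ℚ)) / ℓ)) +
        ratModP (p ^ k) (ratPlusSymbol f ((ℓ : ℚ) * ((v : ℚ) / d))) := by
  have hℓ : ℓ.Prime := hℓK.prime
  haveI : Fact ℓ.Prime := ⟨hℓ⟩
  have hdq : (d : ℚ) ≠ 0 := by exact_mod_cast hd0
  have hℓq : (ℓ : ℚ) ≠ 0 := by exact_mod_cast hℓ.ne_zero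
  have hgood : W.HasGoodReductionAtPrime ℓ := by
    by_contra hbad
    exact hℓK.not_dvd_conductorNorm
      ((W.dvd_conductorNorm_iff_not_hasGoodReductionAtPrime ℓ).mpr hbad)
  have hℓN : ¬ ℓ ∣ N := not_dvd_level_of_isNewformOf hf hgood
  have hℓN' : Nat.Coprime ℓ N := (Nat.Prime.coprime_iff_not_dvd hℓ).mpr hℓN
  have hap : cuspCoeff f ℓ = ((W.frobeniusTrace ℓ : ℤ) : ℂ) :=
    cuspCoeff_eq_frobeniusTrace_of_isNewformOf_holds hf hgood
  have ha2 : ((W.frobeniusTrace ℓ : ℤ) : ZMod (p ^ k)) = 2 :=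
    (Kato.isKolyvaginPrime_iff_zmod.mp hℓK).2.2.2
  have hH0 := intCast_mul_ratPlusSymbol ℓ hf.1 hℓ hℓN hap
    (ratCast_ratPlusSymbol_holds hf.1 hf.coeffField_eq_bot) ((v : ℚ) / d)
  -- integrality of the three kinds of symbols
  have h₀ : ‖((ratPlusSymbol f ((v : ℚ) / d) : ℚ) : ℚ_[p])‖ ≤ 1 :=
    hf.norm_ratPlusSymbol_div_le_one hp2 hirr hdN v
  have hj : ∀ j : Fin ℓ,
      ‖((ratPlusSymbol f (((v : ℚ) / d + ((j : ℕ) : ℚ)) / ℓ) : ℚ) : ℚ_[p])‖ ≤ 1 := by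
    intro j
    have hq : ((v : ℚ) / d + ((j : ℕ) : ℚ)) / ℓ = ((v + d * (j : ℕ) : ℤ) : ℚ) / ((d * ℓ : ℕ) : ℚ) := by
      push_cast
      field_simp
    rw [hq]
    exact hf.norm_ratPlusSymbol_div_le_one hp2 hirr (Nat.Coprime.mul_left hdN hℓN') _
  have h' : ‖((ratPlusSymbol f ((ℓ : ℚ) * ((v : ℚ) / d)) : ℚ) : ℚ_[p])‖ ≤ 1 := by
    have hq : (ℓ : ℚ) * ((v : ℚ) / d) = ((ℓ * v : ℤ) : ℚ) / d := by
      push_cast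
      ring
    rw [hq]
    exact hf.norm_ratPlusSymbol_div_le_one hp2 hirr hdN _
  obtain ⟨hsum, hsum'⟩ := ratModP_pow_sum k (Finset.univ : Finset (Fin ℓ))
    (fun j => ratPlusSymbol f (((v : ℚ) / d + ((j : ℕ) : ℚ)) / ℓ)) (fun j _ => hj j)
  have hred := congrArg (ratModP (p ^ k)) hH0
  rw [ratModP_pow_intCast_mul k _ h₀, ratModP_pow_add k hsum' h', hsum, ha2] at hred
  exact hred

/-- **The functional equation of Kurihara numbers** (Kim, Amer. J. Math. 148 (2026), §3.5, eq. (3.3):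
"`w(E)·(−1)^{ν(n)}·δ̃_n = δ̃_n`"; Kim 2025, eq. (2.1): "`w(f)·(−1)^{ν(n)}·δ_n = δ_n`"; from Mazur–Tate
1987, (1.6.2)), in the Fricke-sign currency and for the tree's `Ω⁺_f`-normalised mod-`p^k` numbers.
Let `W/ℚ` be elliptic, globally minimal, `p` an odd prime with `E[p]` irreducible, `f ∈ S₂(Γ₀(N))` the
newform of `W` with `f|w_N = −σ f` (`σ ∈ ℤ`, `σ² = 1`; `σ = −ε(f)`, `= w(E)` at `N = N_W`), and
`n ∈ 𝒩_k`. Then for every family of discrete logarithms `ψ`,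
`δ_n = σ·(−1)^{ν(n)}·δ_n` in `ℤ/p^k`, `δ_n = kuriharaNumber f (p^k) n ψ`. UNCONDITIONAL (the algebra
is `MazurTate.kuriharaSum_primeFactors_eq_sign_mul`; inputs (P), (H), (F) from the tree, see the
module docstring). [cite: Kim2022StructureSelmer, §3.5 eq. (3.3) (PDF p. 19)]
[cite: MazurTate1987, (1.6.2)] -/
theorem kuriharaNumber_eq_frickeSign_mul (hp2 : p ≠ 2) (hirr : W.HasIrreducibleModPGaloisRep p)
    (hf : IsNewformOf W f) {σ : ℤ} (hσ : σ ^ 2 = 1) (hW : IsFrickeEigen N f (-(σ : ℂ)))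
    {k n : ℕ} [NeZero n] (hn : Kato.IsKolyvaginProduct W p k n)
    (ψ : (ℓ : ℕ) → (ZMod ℓ)ˣ →* Multiplicative (ZMod (p ^ k))) :
    kuriharaNumber f (p ^ k) n ψ =
      (σ : ZMod (p ^ k)) * (-1) ^ n.primeFactors.card * kuriharaNumber f (p ^ k) n ψ := by
  -- the symbol, the characters
  obtain ⟨Λ, hΛ⟩ : ∃ Λ : ℚ → ZMod (p ^ k), ∀ r, Λ r = ratModP (p ^ k) (ratPlusSymbol f r) :=
    ⟨_, fun _ => rfl⟩
  obtain ⟨χ, hχ⟩ : ∃ χ : (d q : ℕ) → (ZMod d)ˣ →* Multiplicative (ZMod (p ^ k)), ∀ d q, χ d q =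
      if h : q ∣ d then (ψ q).comp (ZMod.unitsMap h) else 1 := ⟨_, fun _ _ => rfl⟩
  -- `n` is prime to the level
  have hcop : Nat.Coprime n N := by
    refine Nat.coprime_of_dvd fun q hq hqn hqN => ?_
    haveI : Fact q.Prime := ⟨hq⟩
    have hqK := hn.isKolyvaginPrime hq hqn
    have hgood : W.HasGoodReductionAtPrime q := by
      by_contra hbad
      exact hqK.not_dvd_conductorNorm
        ((W.dvd_conductorNorm_iff_not_hasGoodReductionAtPrime q).mpr hbad)
    exact not_dvd_level_of_isNewformOf hf hgood hqN
  -- the Kurihara number is the top sum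
  have hlink : kuriharaNumber f (p ^ k) n ψ = ∑ b : (ZMod n)ˣ, Λ (((b : ZMod n).val : ℚ) / n) *
      ∏ q ∈ n.primeFactors, Multiplicative.toAdd (χ n q b) := by
    rw [kuriharaNumber_def]
    refine Finset.sum_congr rfl fun b _ => ?_
    rw [hΛ, ← Finset.prod_attach n.primeFactors (fun q => Multiplicative.toAdd (χ n q b))]
    congr 1
    refine Finset.prod_congr rfl fun q _ => ?_
    rw [hχ, dif_pos (Nat.dvd_of_mem_primeFactors q.2), MonoidHom.comp_apply]
  -- (P)
  have hP : ∀ (r : ℚ) (z : ℤ), Λ (r + z) = Λ r := by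
    intro r z
    rw [hΛ, hΛ, ratPlusSymbol_add_intCast_eq]
  -- (H)
  have hH : ∀ ℓ ∈ n.primeFactors, ∀ d : ℕ, d ∣ n → ¬ ℓ ∣ d → ∀ v : ℤ,
      (2 : ZMod (p ^ k)) * Λ ((v : ℚ) / d) =
        ∑ j : Fin ℓ, Λ (((v : ℚ) / d + ((j : ℕ) : ℚ)) / ℓ) + Λ ((ℓ : ℚ) * ((v : ℚ) / d)) := by
    intro ℓ hℓ d hd _ v
    simp only [hΛ]
    exact two_mul_ratModP_ratPlusSymbol_eq_of_isKolyvaginPrime hp2 hirr hf (hn.2 ℓ hℓ)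
      (ne_zero_of_dvd_ne_zero hn.ne_zero hd) (hcop.coprime_dvd_left hd) v
  -- compatibility of the characters
  have hχc : ∀ {d m q : ℕ} (hm : m ∣ d), q ∣ m → ∀ b : (ZMod d)ˣ,
      χ d q b = χ m q (ZMod.unitsMap hm b) := by
    intro d m q hm hq b
    rw [hχ, hχ, dif_pos (hq.trans hm), dif_pos hq, MonoidHom.comp_apply, MonoidHom.comp_apply,
      ← MonoidHom.comp_apply (ZMod.unitsMap hq), ZMod.unitsMap_comp]
  -- (F)
  have hF : ∀ a u v : ℤ, a * n - u * (N * v) = 1 →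
      Λ ((u : ℚ) / n) = (σ : ZMod (p ^ k)) * Λ ((v : ℚ) / n) := by
    intro a u v huv
    rw [hΛ, hΛ, ratPlusSymbol_eq_mul_of_normalizedPlusSymbol_eq f hσ
      (hW.normalizedPlusSymbol_div_eq_mul hσ (NeZero.pos n) huv),
      ratModP_pow_intCast_mul k σ (hf.norm_ratPlusSymbol_div_le_one hp2 hirr hcop v)]
  rw [hlink]
  exact MazurTate.kuriharaSum_primeFactors_eq_sign_mul hP hn.squarefree hH χ hχc hcop.symm hF

/-- **Parity vanishing in the Fricke-sign currency** (Kim 2026, Prop. 3.14; Kim 2025, Prop. 2.5: "If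
`(−1)^{ν(n)} ≠ w(f)`, then `δ_n = 0` … This vanishing is independent of the normalization of modular
symbols"; Kurihara 2014, Lemma 5.2.1): under the hypotheses of `kuriharaNumber_eq_frickeSign_mul`, if
`(−1)^{ν(n)} ≠ σ` then `kuriharaNumber f (p^k) n ψ = 0` for every `ψ` (`δ_n = −δ_n` and `p` is odd).
UNCONDITIONAL. [cite: Kim2022StructureSelmer, Prop. 3.14 (journal) = arXiv v3 Prop. 3.16 (PDF p. 19)]
[cite: Kurihara2014, Lemma 5.2.1] -/
theorem kuriharaNumber_eq_zero_of_neg_one_pow_ne_frickeSign (hp2 : p ≠ 2)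
    (hirr : W.HasIrreducibleModPGaloisRep p) (hf : IsNewformOf W f) {σ : ℤ} (hσ : σ ^ 2 = 1)
    (hW : IsFrickeEigen N f (-(σ : ℂ))) {k n : ℕ} [NeZero n] (hn : Kato.IsKolyvaginProduct W p k n)
    (hne : (-1 : ℤ) ^ n.primeFactors.card ≠ σ)
    (ψ : (ℓ : ℕ) → (ZMod ℓ)ˣ →* Multiplicative (ZMod (p ^ k))) :
    kuriharaNumber f (p ^ k) n ψ = 0 := by
  have h := kuriharaNumber_eq_frickeSign_mul hp2 hirr hf hσ hW hn ψ
  -- `σ (−1)^ν = −1`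
  have hσ1 : σ = 1 ∨ σ = -1 := by
    have h0 : (σ - 1) * (σ + 1) = 0 := by linear_combination hσ
    rcases mul_eq_zero.mp h0 with h1 | h1
    · exact Or.inl (by linear_combination h1)
    · exact Or.inr (by linear_combination h1)
  have hsignZ : σ * (-1 : ℤ) ^ n.primeFactors.card = -1 := by
    rcases neg_one_pow_eq_or ℤ n.primeFactors.card with hν | hν <;> rw [hν] at hne ⊢ <;>
      rcases hσ1 with rfl | rfl <;> simp_all
  have hsign : (σ : ZMod (p ^ k)) * (-1) ^ n.primeFactors.card = -1 := by
    exact_mod_cast congrArg (Int.cast : ℤ → ZMod (p ^ k)) hsignZ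
  rw [hsign, neg_one_mul] at h
  -- `2` is a unit mod `p^k`
  have h2cop : Nat.Coprime 2 (p ^ k) :=
    ((Nat.coprime_primes Nat.prime_two (Fact.out : p.Prime)).mpr (Ne.symm hp2)).pow_right k
  have h2 : IsUnit (2 : ZMod (p ^ k)) := by
    have hu := (ZMod.unitOfCoprime 2 h2cop).isUnit
    rwa [ZMod.coe_unitOfCoprime, Nat.cast_ofNat] at hu
  have h' : (2 : ZMod (p ^ k)) * kuriharaNumber f (p ^ k) n ψ = 0 := by linear_combination h
  exact (h2.mul_right_eq_zero).mp h'

end FrickeSign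

/-! ### The root-number currency at the conductor level (unconditional) -/

section ConductorLevel

variable {W : WeierstrassCurve ℚ} [W.IsElliptic] [W.IsGloballyMinimal] [NeZero (W.conductorNorm ℤ)]
  {f : CuspForm (Gamma0 (W.conductorNorm ℤ)) 2} {p : ℕ} [Fact p.Prime]

omit [W.IsElliptic] [W.IsGloballyMinimal] [NeZero (W.conductorNorm ℤ)] in
/-- `w(E) = ±1`, squared. [folklore] -/
private theorem rootNumber_sq : W.rootNumber ^ 2 = 1 := by
  rcases W.rootNumber_eq_one_or with h | h <;> rw [h] <;> norm_num

omit [W.IsGloballyMinimal] in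
/-- At the conductor level, the newform of `W` is a `w_N`-eigenform with sign `−w(E)`:
`f(−1/(Nτ)) = −w(E) N τ² f(τ)` (`w(E) = −ε(f)`, `rootNumber_eq_neg_frickeEigenvalue`; Atkin–Lehner
`w_N f = ε(f) f`, `IsNewform0.frickeInvolution_eq_smul_holds`). [cite: AtkinLehner1970, Thm. 3] -/
theorem ModularForms.IsNewformOf.isFrickeEigen_neg_rootNumber (hf : IsNewformOf W f) :
    IsFrickeEigen (W.conductorNorm ℤ) f (-((W.rootNumber : ℤ) : ℂ)) := by
  have hw : (W.rootNumber : ℂ) = -frickeEigenvalue f :=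
    rootNumber_eq_neg_frickeEigenvalue (fun _ _ ↦ IsNewform0.exists_functional_equation_holds)
      (fun _ _ ↦ IsNewform0.frickeEigenvalue_eq_one_or_eq_neg_one_holds) hf
  have hsm := IsNewform0.frickeInvolution_eq_smul_holds (N := W.conductorNorm ℤ) (k := (2 : ℤ)) hf.1
  have hFE : IsFrickeEigen (W.conductorNorm ℤ) f (frickeEigenvalue f) :=
    isFrickeEigen_of_frickeInvolution_eq_smul _ hsm
  rw [hw, neg_neg]
  exact hFE

/-- **Eq. (3.3) verbatim at the conductor level** (Kim, Amer. J. Math. 148 (2026), §3.5, (3.3):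
"`w(E)·(−1)^{ν(n)}·δ̃_n = δ̃_n ∈ ℤ_p/I_nℤ_p` where `w(E)` is the root number of `E`"): for `W/ℚ`
elliptic, globally minimal, `p` odd with `E[p]` irreducible, `f ∈ S₂(Γ₀(N_W))` its newform, `n ∈ 𝒩_k`:
`δ_n = w(E)·(−1)^{ν(n)}·δ_n` in `ℤ/p^k`. UNCONDITIONAL.
[cite: Kim2022StructureSelmer, §3.5 eq. (3.3) (PDF p. 19)] -/
theorem kuriharaNumber_eq_rootNumber_mul_conductorLevel (hp2 : p ≠ 2)
    (hirr : W.HasIrreducibleModPGaloisRep p) (hf : IsNewformOf W f) {k n : ℕ} [NeZero n]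
    (hn : Kato.IsKolyvaginProduct W p k n) (ψ : (ℓ : ℕ) → (ZMod ℓ)ˣ →* Multiplicative (ZMod (p ^ k))) :
    kuriharaNumber f (p ^ k) n ψ =
      (W.rootNumber : ZMod (p ^ k)) * (-1) ^ n.primeFactors.card * kuriharaNumber f (p ^ k) n ψ :=
  kuriharaNumber_eq_frickeSign_mul hp2 hirr hf rootNumber_sq hf.isFrickeEigen_neg_rootNumber hn ψ

/-- **Prop. 3.14 verbatim at the conductor level** (Kim 2026, Prop. 3.14 (journal) = arXiv v3
Prop. 3.16: "If `(−1)^{ν(n)} ≠ w(E)`, then `δ̃_n = 0`"; Kurihara 2014, Lemma 5.2.1): with `f` the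
newform of `W` at level `N_W`, `p` odd, `E[p]` irreducible, `n ∈ 𝒩_k` and `(−1)^{ν(n)} ≠ w(E)`, the
mod-`p^k` Kurihara number vanishes for every `ψ`. UNCONDITIONAL.
[cite: Kim2022StructureSelmer, Prop. 3.14 (journal) = arXiv v3 Prop. 3.16 (PDF p. 19)]
[cite: Kurihara2014, Lemma 5.2.1] -/
theorem kuriharaNumber_eq_zero_of_neg_one_pow_ne_rootNumber_conductorLevel (hp2 : p ≠ 2)
    (hirr : W.HasIrreducibleModPGaloisRep p) (hf : IsNewformOf W f) {k n : ℕ} [NeZero n]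
    (hn : Kato.IsKolyvaginProduct W p k n) (hne : (-1 : ℤ) ^ n.primeFactors.card ≠ W.rootNumber)
    (ψ : (ℓ : ℕ) → (ZMod ℓ)ˣ →* Multiplicative (ZMod (p ^ k))) :
    kuriharaNumber f (p ^ k) n ψ = 0 :=
  kuriharaNumber_eq_zero_of_neg_one_pow_ne_frickeSign hp2 hirr hf rootNumber_sq
    hf.isFrickeEigen_neg_rootNumber hn hne ψ

end ConductorLevel

/-! ### The parity of a witnessing level is the parity of the analytic rank -/

section WitnessParity

variable {W : WeierstrassCurve ℚ} [W.IsElliptic] [W.IsGloballyMinimal] [NeZero (W.conductorNorm ℤ)]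
  {f : CuspForm (Gamma0 (W.conductorNorm ℤ)) 2} {p : ℕ} [Fact p.Prime]

/-- **A level carrying a non-zero Kurihara number has the parity of the analytic rank**
(Kurihara 2014, Lemma 5.2.1: "Let `ε` be the root number of `E`. Suppose that `m ∈ 𝒩_1` is
`δ`-minimal [so `δ̃_m ≠ 0`] … Then we have `ε = (−1)^{ε(m)}`", combined with "its parity determines
whether the order of vanishing of `L_{E/ℚ}(s)` at `s = 1` is odd or even", Silverman AEC C.16):
for `W/ℚ` elliptic, globally minimal, `f` its newform at level `N_W`, `p` odd with `E[p]`
irreducible and `n ∈ 𝒩_k` with `kuriharaNumber f (p^k) n ψ ≠ 0` for some `ψ`: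
`(−1)^{ν(n)} = w(E)` and `ν(n) ≡ ord_{s=1} L(E, s) (mod 2)`. UNCONDITIONAL (contrapositive of
`kuriharaNumber_eq_zero_of_neg_one_pow_ne_rootNumber_conductorLevel` + the tree's
`even_analyticRank_iff_of_isNewformOf_conductorLevel`). The shape wanted by certificate searches:
only levels with `ν(n) ≡ r_an (mod 2)` can carry a unit `δ̃_n`.
[cite: Kurihara2014, Lemma 5.2.1] [cite: SilvermanAEC2009, C.16 p. 451 (after Thm. 16.3)] -/
theorem even_card_primeFactors_iff_even_analyticRank_of_kuriharaNumber_ne_zero (hp2 : p ≠ 2)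
    (hirr : W.HasIrreducibleModPGaloisRep p) (hf : IsNewformOf W f) {k n : ℕ} [NeZero n]
    (hn : Kato.IsKolyvaginProduct W p k n) (ψ : (ℓ : ℕ) → (ZMod ℓ)ˣ →* Multiplicative (ZMod (p ^ k)))
    (hne : kuriharaNumber f (p ^ k) n ψ ≠ 0) :
    (Even n.primeFactors.card ↔ Even W.analyticRank) ∧
      (-1 : ℤ) ^ n.primeFactors.card = W.rootNumber := by
  have hsign : (-1 : ℤ) ^ n.primeFactors.card = W.rootNumber := by
    by_contra h
    exact hne (kuriharaNumber_eq_zero_of_neg_one_pow_ne_rootNumber_conductorLevel hp2 hirr hf hn h ψ)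
  have hpar : Even W.analyticRank ↔ W.rootNumber = 1 :=
    Literature.Barriers.BirchSwinnertonDyer.even_analyticRank_iff_of_isNewformOf_conductorLevel hf
  refine ⟨?_, hsign⟩
  rw [hpar, ← hsign, neg_one_pow_eq_one_iff_even (by norm_num)]

/-- **Prop. 3.14, second clause, at the conductor level** (Kim, Amer. J. Math. 148 (2026), Prop. 3.14
(journal) = arXiv v3 Prop. 3.16: "In particular, if `δ̃_n ≠ 0`, then `δ̃_{nℓ} = 0 ∈ ℤ_p/I_{nℓ}ℤ_p` for
all `ℓ ∈ 𝒩_1` with `(n, ℓ) = 1`"), mod `p^k`: for `f` the newform of `W` at level `N_W`, `p` odd,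
`E[p]` irreducible, `n ∈ 𝒩_k` with `kuriharaNumber f (p^k) n ψ ≠ 0` for some `ψ`, and a Kolyvagin
prime `ℓ ∈ 𝒫_k` not dividing `n`: `kuriharaNumber f (p^k) (nℓ) ψ' = 0` for every `ψ'` (the levels `n`
and `nℓ` have opposite parities, and `(−1)^{ν(n)} = w(E)`). UNCONDITIONAL.
[cite: Kim2022StructureSelmer, Prop. 3.14 (journal) = arXiv v3 Prop. 3.16 (PDF p. 19)] -/
theorem kuriharaNumber_mul_eq_zero_of_kuriharaNumber_ne_zero_conductorLevel (hp2 : p ≠ 2)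
    (hirr : W.HasIrreducibleModPGaloisRep p) (hf : IsNewformOf W f) {k n ℓ : ℕ} [NeZero n]
    [NeZero (n * ℓ)] (hn : Kato.IsKolyvaginProduct W p k n) (hℓ : Kato.IsKolyvaginPrime W p k ℓ)
    (hℓn : ¬ ℓ ∣ n) {ψ : (q : ℕ) → (ZMod q)ˣ →* Multiplicative (ZMod (p ^ k))}
    (hne : kuriharaNumber f (p ^ k) n ψ ≠ 0)
    (ψ' : (q : ℕ) → (ZMod q)ˣ →* Multiplicative (ZMod (p ^ k))) :
    kuriharaNumber f (p ^ k) (n * ℓ) ψ' = 0 := by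
  have hsign :=
    (even_card_primeFactors_iff_even_analyticRank_of_kuriharaNumber_ne_zero hp2 hirr hf hn ψ hne).2
  have hcop : Nat.Coprime n ℓ := ((Nat.Prime.coprime_iff_not_dvd hℓ.prime).mpr hℓn).symm
  have hnℓ : Kato.IsKolyvaginProduct W p k (n * ℓ) := hn.mul hℓ.isKolyvaginProduct hcop
  have hdisj : Disjoint n.primeFactors {ℓ} :=
    Finset.disjoint_singleton_right.mpr fun h => hℓn (Nat.dvd_of_mem_primeFactors h)
  have hcard : (n * ℓ).primeFactors.card = n.primeFactors.card + 1 := by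
    rw [Nat.primeFactors_mul (NeZero.ne n) hℓ.prime.ne_zero, hℓ.prime.primeFactors,
      Finset.card_union_of_disjoint hdisj, Finset.card_singleton]
  refine kuriharaNumber_eq_zero_of_neg_one_pow_ne_rootNumber_conductorLevel hp2 hirr hf hnℓ ?_ ψ'
  rw [hcard, pow_succ, hsign]
  rcases W.rootNumber_eq_one_or with h | h <;> rw [h] <;> norm_num

end WitnessParity

/-! ### The named facts follow from modularity at the conductor level -/

section Modularity

/-- **The REFEREED fact `Kim2022_kuriharaNumber_eq_zero_of_neg_one_pow_ne_rootNumber` (Kim 2026,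
Prop. 3.14; Kurihara 2014, Lemma 5.2.1) FOLLOWS FROM MODULARITY** in the tree's form
`exists_isNewformOf` (every elliptic `W/ℚ` has a newform at level `N_W`; BCDT 2001): the fact
quantifies over newforms `f` of `W` at every level `N`, and two newforms of `W` have the same level
(`IsNewformOf.level_eq_level`, strong multiplicity one, proved), so `N = N_W` and
`kuriharaNumber_eq_zero_of_neg_one_pow_ne_rootNumber_conductorLevel` applies (`ρ̄_{E,p}` onto ⇒ `E[p]`
irreducible; `p ≥ 5` ⇒ `p` odd). This reduces the trust base of the fact to `exists_isNewformOf`.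
[cite: Kim2022StructureSelmer, Prop. 3.14 (journal) = arXiv v3 Prop. 3.16 (PDF p. 19)]
[cite: Kurihara2014, Lemma 5.2.1] -/
theorem Kim2022_kuriharaNumber_eq_zero_of_neg_one_pow_ne_rootNumber_of_exists_isNewformOf
    (hmod : exists_isNewformOf) : Kim2022_kuriharaNumber_eq_zero_of_neg_one_pow_ne_rootNumber := by
  intro W _ _ p _ hp5 hsurj N _ f hf k n _ _ hn hne ψ
  haveI : NeZero (W.conductorNorm ℤ) := ⟨(W.conductorNorm_pos_holds).ne'⟩
  obtain ⟨g, hg⟩ := hmod W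
  have hN : N = W.conductorNorm ℤ := hf.level_eq_level hg
  subst hN
  have hp2 : p ≠ 2 := by omega
  exact kuriharaNumber_eq_zero_of_neg_one_pow_ne_rootNumber_conductorLevel hp2
    (hasIrreducibleModPGaloisRep_of_hasSurjectiveModNGaloisRep W p hsurj) hf hn hne ψ

end Modularity

end Literature.NumberTheory.EllipticCurves

namespace Literature.NumberTheory.EllipticCurves.Kim2025

open Literature.NumberTheory.EllipticCurves

/-- **The OPEN `p ≥ 3` twin `prop25_…_OPEN` (Kim 2025, Prop. 2.5, UNREFEREED) also FOLLOWS FROM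
MODULARITY `exists_isNewformOf`** — for elliptic curves its content is Mazur–Tate's functional
equation, proved in the tree (`kuriharaNumber_eq_zero_of_neg_one_pow_ne_rootNumber_conductorLevel`);
the tower hypothesis is used only through `ρ̄_{E,p}` onto ⇒ `E[p]` irreducible, and `p ≥ 3` ⇒ `p` odd.
The claim tag of the `Prop` is unaffected (nothing is asserted about the preprint beyond this
elementary proposition). [cite: Kim2025RefinedTNC, Prop. 2.5 and eq. (2.1) (§2.3.4, chunk p0010)]
[cite: MazurTate1987, (1.6.2)] -/
theorem prop25_kuriharaNumber_eq_zero_of_neg_one_pow_ne_rootNumber_OPEN_of_exists_isNewformOf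
    (hmod : exists_isNewformOf) :
    prop25_kuriharaNumber_eq_zero_of_neg_one_pow_ne_rootNumber_OPEN := by
  intro W _ _ p _ hp3 htower N _ f hf k n _ _ hn hne ψ
  haveI : NeZero (W.conductorNorm ℤ) := ⟨(W.conductorNorm_pos_holds).ne'⟩
  obtain ⟨g, hg⟩ := hmod W
  have hN : N = W.conductorNorm ℤ := hf.level_eq_level hg
  subst hN
  have hp2 : p ≠ 2 := by omega
  have hsurj : W.HasSurjectiveModNGaloisRep p := by simpa using htower 1
  exact kuriharaNumber_eq_zero_of_neg_one_pow_ne_rootNumber_conductorLevel hp2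
    (hasIrreducibleModPGaloisRep_of_hasSurjectiveModNGaloisRep W p hsurj) hf hn hne ψ

end Literature.NumberTheory.EllipticCurves.Kim2025

end
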